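import Mathlib.Algebra.Order.Floor.Ring
import Mathlib.Data.Rat.Floor
import Mathlib.MeasureTheory.Measure.Lebesgue.Integral
import Literature.Analysis.SpecialFunctions.DigammaVerticalSeries
import HarnessLib

/-!
# Certified piecewise-polynomial minorants of the archimedean weight `Re ψ(1/4 + it/2)`

Trunk T-ANT support for the certificate of `WeilPositivityCertificate.lean` (Yoshida's
Theorem 1: Weil positivity on `C((log 2)/2)`; H. Yoshida, Adv. Stud. Pure Math. 21 (1992), §6,
where the weight `Re ψ(1/4 + it/2)` is controlled through `ψ'(s) = Σ (n+s)^{-2}` and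
monotonicity). From the vertical series of
`Literature/Analysis/SpecialFunctions/DigammaVerticalSeries.lean`
(`Re ψ(1/4+it/2) = ψ(1/4) + Σ_m f_{l_m}(t)`, partial sums and the cell inequalities
`Literature.reDigammaQuarter_sub_ge_sum_lin/poly`, the tail bound `Literature.Analysis.SpecialFunctions.sum_digammaTerm_add_tail_le`,
`ψ(1/4) ≥ −4.22745354`) we build a *kernel-checkable* format for minorants
`σ(t) = wL − γ(t) ≤ Re ψ(1/4 + it/2)` with `γ ≥ 0` even, piecewise polynomial on a chain of cells
`[u_j, v_j) ⊆ [0, T)` and `γ = 0` for `|t| ≥ T`: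

* `ratRd`/`ratRu` (dyadic rounding), `sumR`/`allBelow` (structural recursions that reduce well
  under `decide +kernel`), rational forms of the series terms with their casts;
* `wLoQ p u M ≤ Re ψ(1/4 + iu/2)` (`wLoQ_le`), the coefficient sums `aLoQ ≤ A_k ≤ aHiQ`,
  `aLinQ`;
* `WeilCell` (data of a cell), `WeilCell.sigma` (its polynomial `W + Σ_k c_k (t² − u²)^{k+1}`),
  the Boolean checks `WeilCell.check` and their soundness `WeilCell.sigma_le` (`σ ≤ Re ψ` on
  the cell) and `WeilCell.sigma_le_level` (`σ ≤ wL` on the cell);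
* `cellsGamma` (the even function `γ`), `checkCells` (chain + cells + level at `T`) and its
  soundness: `level_sub_cellsGamma_le` (`wL − γ ≤ Re ψ(1/4 + it/2)` for all `t`),
  `cellsGamma_nonneg`, `cellsGamma_eq_zero` (`|t| ≥ T`), boundedness and measurability;
* exact rational moments: `WeilCell.momentQ`, `cellsMomentQ` and
  `integral_cellsGamma_mul_pow`: for even `q`, `∫ γ(t) t^q dt = 2 Σ_j momentQ_j(q)`.

Everything here is proved; there are no named facts.

## References

* H. Yoshida, *On Hermitian forms attached to zeta functions*, Adv. Stud. Pure Math. 21 (1992),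
  281–325, §6 (p. 309: monotonicity of `Re ψ(σ + it)` in `t`; p. 310: Theorem 1).
-/

noncomputable section

open Complex Filter Set MeasureTheory
open scoped Real Topology

namespace Literature.NumberTheory.LFunctions

/-! ## Dyadic rounding and kernel-friendly finite sums -/

/-- Round down to the dyadic grid `2^{-p} ℤ`. [folklore] -/
def ratRd (p : ℕ) (x : ℚ) : ℚ :=
  (⌊x * 2 ^ p⌋ : ℚ) / 2 ^ p

/-- Round up to the dyadic grid `2^{-p} ℤ`. [folklore] -/
def ratRu (p : ℕ) (x : ℚ) : ℚ :=
  -ratRd p (-x)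

/-- `rd(x) ≤ x`. [folklore] -/
theorem ratRd_le (p : ℕ) (x : ℚ) : ratRd p x ≤ x := by
  unfold ratRd
  rw [div_le_iff₀ (by positivity)]
  exact Int.floor_le _

/-- `x ≤ ru(x)`. [folklore] -/
theorem le_ratRu (p : ℕ) (x : ℚ) : x ≤ ratRu p x := by
  unfold ratRu
  have := ratRd_le p (-x)
  linarith

/-- `Σ_{k<n} f k` by structural recursion on `n` (reduces well in the kernel). [folklore] -/
def sumR {α : Type*} [Zero α] [Add α] (n : ℕ) (f : ℕ → α) : α :=
  Nat.rec 0 (fun k acc ↦ acc + f k) n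

/-- `sumR 0 f = 0`. [folklore] -/
@[simp] theorem sumR_zero {α : Type*} [Zero α] [Add α] (f : ℕ → α) : sumR 0 f = 0 := rfl

/-- `sumR (n+1) f = sumR n f + f n`. [folklore] -/
theorem sumR_succ {α : Type*} [Zero α] [Add α] (n : ℕ) (f : ℕ → α) :
    sumR (n + 1) f = sumR n f + f n := rfl

/-- `sumR n f = Σ_{k<n} f k`. [folklore] -/
theorem sumR_eq_sum {α : Type*} [AddCommMonoid α] (n : ℕ) (f : ℕ → α) :
    sumR n f = ∑ k ∈ Finset.range n, f k := by
  induction n with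
  | zero => simp
  | succ n ih => rw [sumR_succ, ih, Finset.sum_range_succ]

/-- `∀ k < n, P k` as a structural Boolean recursion. [folklore] -/
def allBelow (n : ℕ) (P : ℕ → Bool) : Bool :=
  Nat.rec true (fun k acc ↦ acc && P k) n

/-- `allBelow (n+1) P = allBelow n P && P n`. [folklore] -/
theorem allBelow_succ (n : ℕ) (P : ℕ → Bool) : allBelow (n + 1) P = (allBelow n P && P n) := rfl

/-- `allBelow n P = true → P k = true` for `k < n`. [folklore] -/
theorem of_allBelow {n : ℕ} {P : ℕ → Bool} (h : allBelow n P = true) {k : ℕ} (hk : k < n) :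
    P k = true := by
  induction n with
  | zero => exact absurd hk (Nat.not_lt_zero _)
  | succ n ih =>
    rw [allBelow_succ, Bool.and_eq_true] at h
    rcases Nat.lt_succ_iff_lt_or_eq.1 hk with hk' | rfl
    · exact ih h.1 hk'
    · exact h.2

/-! ## Rational forms of the terms of the vertical series -/

/-- `l_m = (4m+1)/2` as a rational. [folklore] -/
def digammaNodeQ (m : ℕ) : ℚ := (4 * m + 1) / 2

/-- Cast of `digammaNodeQ`. [folklore] -/
theorem digammaNodeQ_cast (m : ℕ) : ((digammaNodeQ m : ℚ) : ℝ) = Literature.Analysis.SpecialFunctions.digammaNode m := by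
  unfold digammaNodeQ Literature.Analysis.SpecialFunctions.digammaNode; push_cast; ring

/-- `l_m > 0`. [folklore] -/
theorem digammaNodeQ_pos (m : ℕ) : 0 < digammaNodeQ m := by
  unfold digammaNodeQ; positivity

/-- `f_{l_m}(u) = 2u²/(l_m(l_m² + u²))` as a rational. [folklore] -/
def digammaTermQ (u : ℚ) (m : ℕ) : ℚ :=
  2 * u * u / (digammaNodeQ m * (digammaNodeQ m * digammaNodeQ m + u * u))

/-- Cast of `digammaTermQ`. [folklore] -/
theorem digammaTermQ_cast (u : ℚ) (m : ℕ) :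
    ((digammaTermQ u m : ℚ) : ℝ) = Literature.Analysis.SpecialFunctions.digammaTerm (Literature.Analysis.SpecialFunctions.digammaNode m) u := by
  unfold digammaTermQ Literature.Analysis.SpecialFunctions.digammaTerm
  push_cast
  rw [digammaNodeQ_cast]
  ring

/-- The telescoping tail `u² l_M/(2 (l_M² + u²) l_{M+1})` as a rational. [folklore] -/
def digammaTailQ (u : ℚ) (M : ℕ) : ℚ :=
  u * u * digammaNodeQ M /
    (2 * (digammaNodeQ M * digammaNodeQ M + u * u) * digammaNodeQ (M + 1))

/-- Cast of `digammaTailQ`. [folklore] -/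
theorem digammaTailQ_cast (u : ℚ) (M : ℕ) :
    ((digammaTailQ u M : ℚ) : ℝ) =
      (u : ℝ) ^ 2 * Literature.Analysis.SpecialFunctions.digammaNode M / (2 * (Literature.Analysis.SpecialFunctions.digammaNode M ^ 2 + (u : ℝ) ^ 2) * Literature.Analysis.SpecialFunctions.digammaNode (M + 1)) := by
  unfold digammaTailQ
  push_cast
  rw [digammaNodeQ_cast, digammaNodeQ_cast]
  ring

/-- The certified constant `ψ(1/4) ≥ −4.22745354` as a rational. [folklore] -/
def psiQuarterLo : ℚ := -422745354 / 100000000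

/-- `psiQuarterLo ≤ ψ(1/4)` (`Literature.Analysis.SpecialFunctions.re_digamma_one_quarter_ge`). [folklore] -/
theorem psiQuarterLo_le : ((psiQuarterLo : ℚ) : ℝ) ≤ Literature.Analysis.SpecialFunctions.reDigammaQuarter 0 := by
  rw [Literature.Analysis.SpecialFunctions.reDigammaQuarter_zero]
  have h := Literature.Analysis.SpecialFunctions.re_digamma_one_quarter_ge
  have e : ((psiQuarterLo : ℚ) : ℝ) = -4.22745354 := by
    unfold psiQuarterLo; push_cast; norm_num
  rw [e]
  exact h

/-- Certified lower bound for `Re ψ(1/4 + iu/2)` from `M` rounded terms and the telescoping tail: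
`ψ(1/4)_lo + Σ_{m<M} rd f_{l_m}(u) + rd(tail)`. [folklore] -/
def wLoQ (p : ℕ) (u : ℚ) (M : ℕ) : ℚ :=
  psiQuarterLo + sumR M (fun m ↦ ratRd p (digammaTermQ u m)) + ratRd p (digammaTailQ u M)

/-- **Soundness of `wLoQ`**: `wLoQ p u M ≤ Re ψ(1/4 + iu/2)`. [folklore] -/
theorem wLoQ_le (p : ℕ) (u : ℚ) (M : ℕ) : ((wLoQ p u M : ℚ) : ℝ) ≤ Literature.Analysis.SpecialFunctions.reDigammaQuarter u := by
  have h := Literature.Analysis.SpecialFunctions.sum_digammaTerm_add_tail_le M (u : ℝ)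
  have h1 : ((sumR M (fun m ↦ ratRd p (digammaTermQ u m)) : ℚ) : ℝ) ≤
      ∑ m ∈ Finset.range M, Literature.Analysis.SpecialFunctions.digammaTerm (Literature.Analysis.SpecialFunctions.digammaNode m) u := by
    rw [sumR_eq_sum]
    push_cast
    refine Finset.sum_le_sum fun m _ ↦ ?_
    rw [← digammaTermQ_cast]
    exact_mod_cast ratRd_le p (digammaTermQ u m)
  have h2 : ((ratRd p (digammaTailQ u M) : ℚ) : ℝ) ≤
      (u : ℝ) ^ 2 * Literature.Analysis.SpecialFunctions.digammaNode M / (2 * (Literature.Analysis.SpecialFunctions.digammaNode M ^ 2 + (u : ℝ) ^ 2) * Literature.Analysis.SpecialFunctions.digammaNode (M + 1)) := by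
    rw [← digammaTailQ_cast]
    exact_mod_cast ratRd_le p (digammaTailQ u M)
  have h3 := psiQuarterLo_le
  unfold wLoQ
  push_cast
  linarith

/-- The coefficient terms `2 l_m/(l_m² + u²)^{k+2}` as rationals. [folklore] -/
def aTermQ (u : ℚ) (m k : ℕ) : ℚ :=
  2 * digammaNodeQ m / (digammaNodeQ m * digammaNodeQ m + u * u) ^ (k + 2)

/-- Cast of `aTermQ`. [folklore] -/
theorem aTermQ_cast (u : ℚ) (m k : ℕ) :
    ((aTermQ u m k : ℚ) : ℝ) = 2 * Literature.Analysis.SpecialFunctions.digammaNode m / (Literature.Analysis.SpecialFunctions.digammaNode m ^ 2 + (u : ℝ) ^ 2) ^ (k + 2) := by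
  unfold aTermQ; push_cast; rw [digammaNodeQ_cast]; ring

/-- Rounded-down partial sums `Σ_{m<M} rd(2 l_m/(l_m²+u²)^{k+2})`. [folklore] -/
def aLoQ (p : ℕ) (u : ℚ) (M k : ℕ) : ℚ := sumR M fun m ↦ ratRd p (aTermQ u m k)

/-- Rounded-up partial sums `Σ_{m<M} ru(2 l_m/(l_m²+u²)^{k+2})`. [folklore] -/
def aHiQ (p : ℕ) (u : ℚ) (M k : ℕ) : ℚ := sumR M fun m ↦ ratRu p (aTermQ u m k)

/-- `aLoQ ≤ Σ_{m<M} 2 l_m/(l_m²+u²)^{k+2}`. [folklore] -/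
theorem aLoQ_le (p : ℕ) (u : ℚ) (M k : ℕ) :
    ((aLoQ p u M k : ℚ) : ℝ) ≤
      ∑ m ∈ Finset.range M, 2 * Literature.Analysis.SpecialFunctions.digammaNode m / (Literature.Analysis.SpecialFunctions.digammaNode m ^ 2 + (u : ℝ) ^ 2) ^ (k + 2) := by
  unfold aLoQ; rw [sumR_eq_sum]; push_cast
  refine Finset.sum_le_sum fun m _ ↦ ?_
  rw [← aTermQ_cast]; exact_mod_cast ratRd_le p _

/-- `Σ_{m<M} 2 l_m/(l_m²+u²)^{k+2} ≤ aHiQ`. [folklore] -/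
theorem le_aHiQ (p : ℕ) (u : ℚ) (M k : ℕ) :
    ∑ m ∈ Finset.range M, 2 * Literature.Analysis.SpecialFunctions.digammaNode m / (Literature.Analysis.SpecialFunctions.digammaNode m ^ 2 + (u : ℝ) ^ 2) ^ (k + 2) ≤
      ((aHiQ p u M k : ℚ) : ℝ) := by
  unfold aHiQ; rw [sumR_eq_sum]; push_cast
  refine Finset.sum_le_sum fun m _ ↦ ?_
  rw [← aTermQ_cast]; exact_mod_cast le_ratRu p _

/-- The linear-cell slope terms `2 l_m/((l_m² + u²)(l_m² + v²))`. [folklore] -/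
def linTermQ (u v : ℚ) (m : ℕ) : ℚ :=
  2 * digammaNodeQ m /
    ((digammaNodeQ m * digammaNodeQ m + u * u) * (digammaNodeQ m * digammaNodeQ m + v * v))

/-- Cast of `linTermQ`. [folklore] -/
theorem linTermQ_cast (u v : ℚ) (m : ℕ) :
    ((linTermQ u v m : ℚ) : ℝ) =
      2 * Literature.Analysis.SpecialFunctions.digammaNode m / ((Literature.Analysis.SpecialFunctions.digammaNode m ^ 2 + (u : ℝ) ^ 2) * (Literature.Analysis.SpecialFunctions.digammaNode m ^ 2 + (v : ℝ) ^ 2)) := by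
  unfold linTermQ; push_cast; rw [digammaNodeQ_cast]; ring

/-- Rounded-down slope `Σ_{m<M} rd(2 l_m/((l_m²+u²)(l_m²+v²)))`. [folklore] -/
def aLinQ (p : ℕ) (u v : ℚ) (M : ℕ) : ℚ := sumR M fun m ↦ ratRd p (linTermQ u v m)

/-- `aLinQ ≤ Σ_{m<M} 2 l_m/((l_m²+u²)(l_m²+v²))`. [folklore] -/
theorem aLinQ_le (p : ℕ) (u v : ℚ) (M : ℕ) :
    ((aLinQ p u v M : ℚ) : ℝ) ≤
      ∑ m ∈ Finset.range M,
        2 * Literature.Analysis.SpecialFunctions.digammaNode m / ((Literature.Analysis.SpecialFunctions.digammaNode m ^ 2 + (u : ℝ) ^ 2) * (Literature.Analysis.SpecialFunctions.digammaNode m ^ 2 + (v : ℝ) ^ 2)) := by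
  unfold aLinQ; rw [sumR_eq_sum]; push_cast
  refine Finset.sum_le_sum fun m _ ↦ ?_
  rw [← linTermQ_cast]; exact_mod_cast ratRd_le p _

/-! ## Cells -/

/-- A cell `[u, v]` of a certified minorant: the claimed lower bound `W ≤ Re ψ(1/4 + iu/2)`, the
coefficients `c_k` of `σ(t) = W + Σ_k c_k (t² − u²)^{k+1}`, a flag for linear cells (slope certified
against `Σ 2l/((l²+u²)(l²+v²))`) and the truncation orders used by the checks. [folklore] -/
structure WeilCell where
  /-- left end point -/
  u : ℚ
  /-- right end point -/
  v : ℚ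
  /-- claimed lower bound for the weight at `u` -/
  W : ℚ
  /-- coefficients of `(t² - u²)^{k+1}` -/
  c : List ℚ
  /-- linear cell? -/
  lin : Bool
  /-- number of series terms for the `W` check -/
  mw : ℕ
  /-- number of series terms for the coefficient checks -/
  ma : ℕ

namespace WeilCell

/-- The `k`-th coefficient (zero beyond the list). [folklore] -/
def coeff (c : WeilCell) (k : ℕ) : ℚ := c.c.getD k 0

/-- The cell polynomial `σ(t) = W + Σ_{k<len} c_k (t² − u²)^{k+1}`. [folklore] -/
def sigma (c : WeilCell) (t : ℝ) : ℝ :=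
  c.W + ∑ k ∈ Finset.range c.c.length, (c.coeff k : ℝ) * (t ^ 2 - (c.u : ℝ) ^ 2) ^ (k + 1)

/-- Coefficient checks: linear cells against the certified slope, polynomial cells termwise against
the rounded partial sums (`c_k ≤ A_k` for even `k`, `A_k ≤ -c_k` for odd `k`). [folklore] -/
def checkCoeffs (p : ℕ) (c : WeilCell) : Bool :=
  if c.lin then (c.c.length == 1) && decide (c.coeff 0 ≤ aLinQ p c.u c.v c.ma)
  else (c.c.length % 2 == 0) &&
    allBelow c.c.length fun k ↦
      if k % 2 = 0 then decide (c.coeff k ≤ aLoQ p c.u c.ma k)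
      else decide (aHiQ p c.u c.ma k ≤ -c.coeff k)

/-- `W + Σ_{c_k > 0} c_k (v² − u²)^{k+1}`, an upper bound for `σ` on the cell. [folklore] -/
def posPartQ (c : WeilCell) : ℚ :=
  c.W + sumR c.c.length fun k ↦
    if 0 < c.coeff k then c.coeff k * (c.v * c.v - c.u * c.u) ^ (k + 1) else 0

/-- All checks of a cell against the level `wL`. [folklore] -/
def check (p : ℕ) (wL : ℚ) (c : WeilCell) : Bool :=
  decide (0 ≤ c.u) && decide (c.u < c.v) && decide (c.W ≤ wLoQ p c.u c.mw) && c.checkCoeffs p &&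
    decide (c.posPartQ ≤ wL)

variable {p : ℕ} {wL : ℚ} {c : WeilCell}

/-- A checked cell has `0 ≤ u`. [folklore] -/
theorem u_nonneg (h : c.check p wL = true) : 0 ≤ c.u := by
  simp only [check, Bool.and_eq_true, decide_eq_true_eq] at h
  exact h.1.1.1.1

/-- A checked cell has `u < v`. [folklore] -/
theorem u_lt_v (h : c.check p wL = true) : c.u < c.v := by
  simp only [check, Bool.and_eq_true, decide_eq_true_eq] at h
  exact h.1.1.1.2

/-- A checked cell has `W ≤ Re ψ(1/4 + iu/2)`. [folklore] -/
theorem W_le (h : c.check p wL = true) : ((c.W : ℚ) : ℝ) ≤ Literature.Analysis.SpecialFunctions.reDigammaQuarter c.u := by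
  simp only [check, Bool.and_eq_true, decide_eq_true_eq] at h
  exact le_trans (by exact_mod_cast h.1.1.2) (wLoQ_le p c.u c.mw)

/-- **Cell soundness.** On its cell, `σ(t) ≤ Re ψ(1/4 + it/2)`. [folklore] -/
theorem sigma_le (h : c.check p wL = true) {t : ℝ} (hut : (c.u : ℝ) ≤ t) (htv : t ≤ (c.v : ℝ)) :
    c.sigma t ≤ Literature.Analysis.SpecialFunctions.reDigammaQuarter t := by
  have hu : (0 : ℝ) ≤ c.u := by exact_mod_cast u_nonneg h
  have hW := W_le h
  have hs0 : 0 ≤ t ^ 2 - (c.u : ℝ) ^ 2 := by nlinarith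
  have hc : c.checkCoeffs p = true := by
    simp only [check, Bool.and_eq_true, decide_eq_true_eq] at h
    exact h.1.2
  unfold checkCoeffs at hc
  unfold sigma
  split_ifs at hc with hlin
  · -- linear cell
    simp only [Bool.and_eq_true, beq_iff_eq, decide_eq_true_eq] at hc
    rw [hc.1, Finset.sum_range_one, zero_add, pow_one]
    have h1 := Literature.Analysis.SpecialFunctions.reDigammaQuarter_sub_ge_sum_lin hu hut htv c.ma
    have h2 := aLinQ_le p c.u c.v c.ma
    have h3 : ((c.coeff 0 : ℚ) : ℝ) ≤ aLinQ p c.u c.v c.ma := by exact_mod_cast hc.2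
    have h4 : ((c.coeff 0 : ℚ) : ℝ) * (t ^ 2 - (c.u : ℝ) ^ 2) ≤
        (∑ m ∈ Finset.range c.ma, 2 * Literature.Analysis.SpecialFunctions.digammaNode m /
          ((Literature.Analysis.SpecialFunctions.digammaNode m ^ 2 + (c.u : ℝ) ^ 2) * (Literature.Analysis.SpecialFunctions.digammaNode m ^ 2 + (c.v : ℝ) ^ 2))) *
          (t ^ 2 - (c.u : ℝ) ^ 2) :=
      mul_le_mul_of_nonneg_right (h3.trans h2) hs0
    rw [Finset.sum_mul] at h4
    have h5 : ∑ m ∈ Finset.range c.ma, 2 * Literature.Analysis.SpecialFunctions.digammaNode m /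
        ((Literature.Analysis.SpecialFunctions.digammaNode m ^ 2 + (c.u : ℝ) ^ 2) * (Literature.Analysis.SpecialFunctions.digammaNode m ^ 2 + (c.v : ℝ) ^ 2)) *
        (t ^ 2 - (c.u : ℝ) ^ 2) =
        ∑ m ∈ Finset.range c.ma, 2 * Literature.Analysis.SpecialFunctions.digammaNode m * (t ^ 2 - (c.u : ℝ) ^ 2) /
        ((Literature.Analysis.SpecialFunctions.digammaNode m ^ 2 + (c.u : ℝ) ^ 2) * (Literature.Analysis.SpecialFunctions.digammaNode m ^ 2 + (c.v : ℝ) ^ 2)) :=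
      Finset.sum_congr rfl fun m _ ↦ by ring
    rw [h5] at h4
    linarith
  · -- polynomial cell with `2r` coefficients
    simp only [Bool.and_eq_true, beq_iff_eq] at hc
    obtain ⟨hlen, hall⟩ := hc
    obtain ⟨r, hr⟩ : ∃ r, c.c.length = 2 * r := ⟨c.c.length / 2, by omega⟩
    have hut2 : (c.u : ℝ) ^ 2 ≤ t ^ 2 := by nlinarith
    have h1 := Literature.Analysis.SpecialFunctions.reDigammaQuarter_sub_ge_sum_poly hut2 c.ma r
    rw [Finset.sum_comm] at h1
    -- termwise comparison
    have h2 : ∑ k ∈ Finset.range c.c.length, ((c.coeff k : ℚ) : ℝ) * (t ^ 2 - (c.u : ℝ) ^ 2) ^ (k + 1) ≤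
        ∑ k ∈ Finset.range (2 * r), ∑ m ∈ Finset.range c.ma,
          (-1) ^ k * (2 * Literature.Analysis.SpecialFunctions.digammaNode m) * (t ^ 2 - (c.u : ℝ) ^ 2) ^ (k + 1) /
            (Literature.Analysis.SpecialFunctions.digammaNode m ^ 2 + (c.u : ℝ) ^ 2) ^ (k + 2) := by
      rw [hr]
      refine Finset.sum_le_sum fun k hk ↦ ?_
      have hk' : k < c.c.length := by rw [hr]; exact Finset.mem_range.1 hk
      have hPk := of_allBelow hall hk'
      have e : ∑ m ∈ Finset.range c.ma,
          (-1) ^ k * (2 * Literature.Analysis.SpecialFunctions.digammaNode m) * (t ^ 2 - (c.u : ℝ) ^ 2) ^ (k + 1) /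
            (Literature.Analysis.SpecialFunctions.digammaNode m ^ 2 + (c.u : ℝ) ^ 2) ^ (k + 2) =
          ((-1) ^ k * ∑ m ∈ Finset.range c.ma,
            2 * Literature.Analysis.SpecialFunctions.digammaNode m / (Literature.Analysis.SpecialFunctions.digammaNode m ^ 2 + (c.u : ℝ) ^ 2) ^ (k + 2)) *
            (t ^ 2 - (c.u : ℝ) ^ 2) ^ (k + 1) := by
        rw [Finset.mul_sum, Finset.sum_mul]
        refine Finset.sum_congr rfl fun m _ ↦ ?_
        ring
      rw [e]
      refine mul_le_mul_of_nonneg_right ?_ (pow_nonneg hs0 _)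
      rcases Nat.even_or_odd k with he | ho
      · have hk0 : k % 2 = 0 := Nat.even_iff.1 he
        simp only [hk0, ↓reduceIte, decide_eq_true_eq] at hPk
        rw [he.neg_one_pow, one_mul]
        exact le_trans (by exact_mod_cast hPk) (aLoQ_le p c.u c.ma k)
      · have hk1 : k % 2 = 1 := Nat.odd_iff.1 ho
        simp only [hk1, one_ne_zero, ↓reduceIte, decide_eq_true_eq] at hPk
        rw [ho.neg_one_pow, neg_one_mul]
        have := le_aHiQ p c.u c.ma k
        have h' : ((aHiQ p c.u c.ma k : ℚ) : ℝ) ≤ -((c.coeff k : ℚ) : ℝ) := by exact_mod_cast hPk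
        linarith
    linarith

/-- On its cell, `σ(t) ≤ wL` (so the local `γ = wL − σ ≥ 0`). [folklore] -/
theorem sigma_le_level (h : c.check p wL = true) {t : ℝ} (hut : (c.u : ℝ) ≤ t)
    (htv : t ≤ (c.v : ℝ)) : c.sigma t ≤ wL := by
  have hu : (0 : ℝ) ≤ c.u := by exact_mod_cast u_nonneg h
  have hpos : c.posPartQ ≤ wL := by
    simp only [check, Bool.and_eq_true, decide_eq_true_eq] at h
    exact h.2
  have hs0 : 0 ≤ t ^ 2 - (c.u : ℝ) ^ 2 := by nlinarith
  have hsmax : t ^ 2 - (c.u : ℝ) ^ 2 ≤ (c.v : ℝ) * c.v - (c.u : ℝ) * c.u := by nlinarith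
  have key : c.sigma t ≤ ((c.posPartQ : ℚ) : ℝ) := by
    unfold sigma posPartQ
    rw [sumR_eq_sum]
    push_cast
    refine add_le_add le_rfl (Finset.sum_le_sum fun k _ ↦ ?_)
    split_ifs with hck
    · push_cast
      exact mul_le_mul_of_nonneg_left (pow_le_pow_left₀ hs0 hsmax _) (by exact_mod_cast hck.le)
    · push_cast
      exact mul_nonpos_of_nonpos_of_nonneg (by exact_mod_cast not_lt.1 hck) (pow_nonneg hs0 _)
  exact key.trans (by exact_mod_cast hpos)

/-- Continuity of the cell polynomial. [folklore] -/
theorem continuous_sigma (c : WeilCell) : Continuous c.sigma := by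
  unfold sigma; fun_prop

end WeilCell

/-! ## The piecewise minorant built from a chain of cells -/

/-- `γ` on `[0, ∞)`: `Σ_j 1_{[u_j, v_j)}(s) (wL − σ_j(s))`. [folklore] -/
def gammaAux (wL : ℚ) : List WeilCell → ℝ → ℝ
  | [], _ => 0
  | c :: cs, s => Set.indicator (Ico (c.u : ℝ) c.v) (fun s ↦ (wL : ℝ) - c.sigma s) s + gammaAux wL cs s

/-- The even function `γ(t) = γ_{≥0}(|t|)`; the minorant of the weight is `σ = wL − γ`. [folklore] -/
def cellsGamma (wL : ℚ) (cells : List WeilCell) (t : ℝ) : ℝ :=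
  gammaAux wL cells |t|

/-- The cells are consecutive: `u_0 = s`, `u_{j+1} = v_j`, last `v = T`. [folklore] -/
def checkChain : List WeilCell → ℚ → ℚ → Bool
  | [], s, T => decide (s = T)
  | c :: cs, s, T => decide (c.u = s) && checkChain cs c.v T

/-- All checks of a certified minorant on `[0, T]` at level `wL`: a chain of cells from `0` to `T`,
every cell checked, and `wL ≤` (certified lower bound of the weight at `T`). [folklore] -/
def checkCells (p : ℕ) (wL T : ℚ) (mwT : ℕ) (cells : List WeilCell) : Bool :=
  checkChain cells 0 T && cells.all (WeilCell.check p wL) && decide (wL ≤ wLoQ p T mwT)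

section Chain

variable {p : ℕ} {wL : ℚ}

/-- A checked chain from `s` to `T` has `s ≤ T` and all cells inside `[s, T]`. [folklore] -/
theorem chain_bounds {cells : List WeilCell} {s T : ℚ} (hchain : checkChain cells s T = true)
    (hall : ∀ c ∈ cells, c.check p wL = true) :
    s ≤ T ∧ ∀ c ∈ cells, s ≤ c.u ∧ c.v ≤ T := by
  induction cells generalizing s with
  | nil =>
    simp only [checkChain, decide_eq_true_eq] at hchain
    exact ⟨hchain.le, fun c hc ↦ by simp at hc⟩
  | cons c cs ih =>
    simp only [checkChain, Bool.and_eq_true, decide_eq_true_eq] at hchain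
    have hc := hall c (by simp)
    have huv := WeilCell.u_lt_v hc
    have ih' := ih hchain.2 fun c' hc' ↦ hall c' (by simp [hc'])
    refine ⟨by rw [← hchain.1]; exact huv.le.trans ih'.1, fun c' hc' ↦ ?_⟩
    simp only [List.mem_cons] at hc'
    rcases hc' with rfl | hc'
    · exact ⟨hchain.1.ge, ih'.1⟩
    · have := ih'.2 c' hc'
      exact ⟨hchain.1 ▸ huv.le.trans this.1, this.2⟩

/-- `γ_{≥0}` vanishes off `[s, T)`. [folklore] -/
theorem gammaAux_eq_zero {cells : List WeilCell} {s T : ℚ} (hchain : checkChain cells s T = true)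
    (hall : ∀ c ∈ cells, c.check p wL = true) {x : ℝ} (hx : x < s ∨ (T : ℝ) ≤ x) :
    gammaAux wL cells x = 0 := by
  induction cells generalizing s with
  | nil => rfl
  | cons c cs ih =>
    have hb := chain_bounds hchain hall
    simp only [checkChain, Bool.and_eq_true, decide_eq_true_eq] at hchain
    have hcv : (c.v : ℝ) ≤ T := by exact_mod_cast (hb.2 c (by simp)).2
    have huv : (c.u : ℝ) < c.v := by exact_mod_cast WeilCell.u_lt_v (hall c (by simp))
    have hus : (c.u : ℝ) = s := by exact_mod_cast hchain.1
    simp only [gammaAux]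
    rw [ih hchain.2 (fun c' hc' ↦ hall c' (by simp [hc'])) ?_, add_zero, Set.indicator_of_notMem]
    · rintro ⟨h1, h2⟩
      rcases hx with hx | hx <;> linarith
    · rcases hx with hx | hx
      · left; linarith
      · right; exact hx

/-- On `[s, T)`, `γ_{≥0}(x) = wL − σ_j(x)` for the cell containing `x`. [folklore] -/
theorem gammaAux_spec {cells : List WeilCell} {s T : ℚ} (hchain : checkChain cells s T = true)
    (hall : ∀ c ∈ cells, c.check p wL = true) {x : ℝ} (h1 : (s : ℝ) ≤ x) (h2 : x < T) :
    ∃ c ∈ cells, (c.u : ℝ) ≤ x ∧ x < c.v ∧ gammaAux wL cells x = wL - c.sigma x := by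
  induction cells generalizing s with
  | nil =>
    simp only [checkChain, decide_eq_true_eq] at hchain
    rw [hchain] at h1
    linarith
  | cons c cs ih =>
    simp only [checkChain, Bool.and_eq_true, decide_eq_true_eq] at hchain
    have hus : (c.u : ℝ) = s := by exact_mod_cast hchain.1
    have hall' : ∀ c' ∈ cs, c'.check p wL = true := fun c' hc' ↦ hall c' (by simp [hc'])
    by_cases hxv : x < c.v
    · refine ⟨c, by simp, by linarith, hxv, ?_⟩
      simp only [gammaAux]
      have hmem : x ∈ Ico (c.u : ℝ) c.v := ⟨by linarith, hxv⟩
      rw [gammaAux_eq_zero hchain.2 hall' (Or.inl hxv), add_zero, Set.indicator_of_mem hmem]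
    · push Not at hxv
      obtain ⟨c', hc', hr⟩ := ih hchain.2 hall' hxv
      refine ⟨c', by simp [hc'], hr.1, hr.2.1, ?_⟩
      simp only [gammaAux]
      rw [Set.indicator_of_notMem (fun h ↦ not_lt.2 hxv h.2), zero_add, hr.2.2]

/-- `γ_{≥0} ≥ 0` when all cells are checked. [folklore] -/
theorem gammaAux_nonneg {cells : List WeilCell} (hall : ∀ c ∈ cells, c.check p wL = true)
    (x : ℝ) : 0 ≤ gammaAux wL cells x := by
  induction cells with
  | nil => exact le_rfl
  | cons c cs ih =>
    simp only [gammaAux]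
    refine add_nonneg (Set.indicator_nonneg (fun y hy ↦ ?_) _)
      (ih fun c' hc' ↦ hall c' (by simp [hc']))
    exact sub_nonneg.2 (WeilCell.sigma_le_level (hall c (by simp)) hy.1 hy.2.le)

end Chain

/-- `γ_{≥0}` is bounded. [folklore] -/
theorem exists_abs_gammaAux_le (wL : ℚ) (cells : List WeilCell) :
    ∃ B, ∀ x, |gammaAux wL cells x| ≤ B := by
  induction cells with
  | nil => exact ⟨0, fun x ↦ by simp [gammaAux]⟩
  | cons c cs ih =>
    obtain ⟨B, hB⟩ := ih
    obtain ⟨C, hC⟩ := (isCompact_Icc (a := (c.u : ℝ)) (b := c.v)).exists_bound_of_continuousOn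
      ((continuous_const.sub c.continuous_sigma).continuousOn
        (s := Icc (c.u : ℝ) c.v) (f := fun s ↦ (wL : ℝ) - c.sigma s))
    refine ⟨max C 0 + B, fun x ↦ ?_⟩
    simp only [gammaAux]
    refine (abs_add_le _ _).trans (add_le_add ?_ (hB x))
    by_cases hx : x ∈ Ico (c.u : ℝ) c.v
    · rw [Set.indicator_of_mem hx]
      have := hC x (Ico_subset_Icc_self hx)
      rw [Real.norm_eq_abs] at this
      exact this.trans (le_max_left _ _)
    · rw [Set.indicator_of_notMem hx, abs_zero]
      exact le_max_right _ _

/-- `γ` is bounded. [folklore] -/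
theorem exists_abs_cellsGamma_le (wL : ℚ) (cells : List WeilCell) :
    ∃ B, 0 ≤ B ∧ ∀ t, |cellsGamma wL cells t| ≤ B := by
  obtain ⟨B, hB⟩ := exists_abs_gammaAux_le wL cells
  exact ⟨B, (abs_nonneg _).trans (hB 0), fun t ↦ hB |t|⟩

/-- `γ_{≥0}` is measurable. [folklore] -/
theorem measurable_gammaAux (wL : ℚ) (cells : List WeilCell) : Measurable (gammaAux wL cells) := by
  induction cells with
  | nil => exact measurable_const
  | cons c cs ih =>
    change Measurable fun s ↦
      Set.indicator (Ico (c.u : ℝ) c.v) (fun s ↦ (wL : ℝ) - c.sigma s) s + gammaAux wL cs s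
    exact ((measurable_const.sub c.continuous_sigma.measurable).indicator measurableSet_Ico).add ih

/-- `γ` is measurable. [folklore] -/
theorem measurable_cellsGamma (wL : ℚ) (cells : List WeilCell) :
    Measurable (cellsGamma wL cells) :=
  (measurable_gammaAux wL cells).comp continuous_abs.measurable

/-- `Re ψ(1/4 + i|t|/2) = Re ψ(1/4 + it/2)`. [folklore] -/
theorem reDigammaQuarter_abs (t : ℝ) : Literature.Analysis.SpecialFunctions.reDigammaQuarter |t| = Literature.Analysis.SpecialFunctions.reDigammaQuarter t := by
  rcases le_or_gt 0 t with ht | ht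
  · rw [abs_of_nonneg ht]
  · rw [abs_of_neg ht, Literature.Analysis.SpecialFunctions.reDigammaQuarter_even]

section Sound

variable {p : ℕ} {wL T : ℚ} {mwT : ℕ} {cells : List WeilCell}

/-- Unpacking `checkCells`. [folklore] -/
theorem checkCells_spec (h : checkCells p wL T mwT cells = true) :
    checkChain cells 0 T = true ∧ (∀ c ∈ cells, c.check p wL = true) ∧ wL ≤ wLoQ p T mwT := by
  simp only [checkCells, Bool.and_eq_true, List.all_eq_true, decide_eq_true_eq] at h
  exact ⟨h.1.1, h.1.2, h.2⟩

/-- **Soundness of a certified minorant.** `wL − γ(t) ≤ Re ψ(1/4 + it/2)` for all real `t`. [folklore] -/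
theorem level_sub_cellsGamma_le (h : checkCells p wL T mwT cells = true) (t : ℝ) :
    (wL : ℝ) - cellsGamma wL cells t ≤ Literature.Analysis.SpecialFunctions.reDigammaQuarter t := by
  obtain ⟨hchain, hall, hwL⟩ := checkCells_spec h
  have hT : (0 : ℝ) ≤ T := by exact_mod_cast (chain_bounds hchain hall).1
  rw [← reDigammaQuarter_abs t]
  unfold cellsGamma
  have hx0 : (0 : ℝ) ≤ |t| := abs_nonneg t
  rcases lt_or_ge |t| (T : ℝ) with hxT | hxT
  · obtain ⟨c, hc, hux, hxv, hval⟩ := gammaAux_spec hchain hall (by exact_mod_cast hx0) hxT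
    rw [hval, sub_sub_cancel]
    exact WeilCell.sigma_le (hall c hc) hux hxv.le
  · rw [gammaAux_eq_zero hchain hall (Or.inr hxT), sub_zero]
    calc ((wL : ℚ) : ℝ) ≤ wLoQ p T mwT := by exact_mod_cast hwL
      _ ≤ Literature.Analysis.SpecialFunctions.reDigammaQuarter T := wLoQ_le p T mwT
      _ ≤ Literature.Analysis.SpecialFunctions.reDigammaQuarter |t| := Literature.Analysis.SpecialFunctions.reDigammaQuarter_mono (by rwa [abs_abs, abs_of_nonneg hT])

/-- `γ ≥ 0`. [folklore] -/
theorem cellsGamma_nonneg (h : checkCells p wL T mwT cells = true) (t : ℝ) :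
    0 ≤ cellsGamma wL cells t :=
  gammaAux_nonneg (checkCells_spec h).2.1 _

/-- `γ(t) = 0` for `|t| ≥ T`. [folklore] -/
theorem cellsGamma_eq_zero (h : checkCells p wL T mwT cells = true) {t : ℝ} (ht : (T : ℝ) ≤ |t|) :
    cellsGamma wL cells t = 0 :=
  gammaAux_eq_zero (checkCells_spec h).1 (checkCells_spec h).2.1 (Or.inr ht)

end Sound

/-! ## Exact moments of the minorant -/

namespace WeilCell

/-- `(v^e − u^e)/e`, the integral of `s^{e-1}` over the cell. [folklore] -/
def powIntQ (c : WeilCell) (e : ℕ) : ℚ := (c.v ^ e - c.u ^ e) / e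

/-- `∫_u^v (wL − σ(s)) s^q ds` in closed form (binomial expansion of `(s² − u²)^{k+1}`). [folklore] -/
def momentQ (wL : ℚ) (c : WeilCell) (q : ℕ) : ℚ :=
  (wL - c.W) * c.powIntQ (q + 1) -
    sumR c.c.length fun k ↦ c.coeff k *
      sumR (k + 2) fun i ↦ ((k + 1).choose i : ℚ) * (-(c.u * c.u)) ^ (k + 1 - i) *
        c.powIntQ (2 * i + q + 1)

/-- `∫_u^v s^e ds = powIntQ (e+1)`. [folklore] -/
theorem integral_pow_eq_powIntQ (c : WeilCell) (e : ℕ) :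
    ∫ s in (c.u : ℝ)..c.v, s ^ e = (c.powIntQ (e + 1) : ℝ) := by
  rw [integral_pow, powIntQ]
  push_cast
  ring

/-- **Cell moments.** `∫_u^v (wL − σ(s)) s^q ds = momentQ`. [folklore] -/
theorem integral_level_sub_sigma_mul_pow (wL : ℚ) (c : WeilCell) (q : ℕ) :
    ∫ s in (c.u : ℝ)..c.v, ((wL : ℝ) - c.sigma s) * s ^ q = (c.momentQ wL q : ℝ) := by
  -- pointwise expansion
  set P : ℕ → ℕ → ℝ → ℝ := fun k i s ↦
    ((k + 1).choose i : ℝ) * (-((c.u : ℝ) * c.u)) ^ (k + 1 - i) * s ^ (2 * i + q) with hP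
  have hexp : ∀ (k : ℕ) (s : ℝ), (s ^ 2 - (c.u : ℝ) ^ 2) ^ (k + 1) * s ^ q =
      ∑ i ∈ Finset.range (k + 2), P k i s := by
    intro k s
    rw [sub_eq_add_neg, add_pow, Finset.sum_mul]
    refine Finset.sum_congr rfl fun i _ ↦ ?_
    rw [hP]
    simp only
    rw [← pow_mul, pow_two (c.u : ℝ)]
    ring
  have hpt : ∀ s : ℝ, ((wL : ℝ) - c.sigma s) * s ^ q =
      ((wL : ℝ) - c.W) * s ^ q -
        ∑ k ∈ Finset.range c.c.length, (c.coeff k : ℝ) * ∑ i ∈ Finset.range (k + 2), P k i s := by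
    intro s
    unfold sigma
    rw [show ((wL : ℝ) - (c.W + ∑ k ∈ Finset.range c.c.length,
        (c.coeff k : ℝ) * (s ^ 2 - (c.u : ℝ) ^ 2) ^ (k + 1))) * s ^ q =
        ((wL : ℝ) - c.W) * s ^ q - (∑ k ∈ Finset.range c.c.length,
        (c.coeff k : ℝ) * (s ^ 2 - (c.u : ℝ) ^ 2) ^ (k + 1)) * s ^ q by ring, Finset.sum_mul]
    congr 1
    refine Finset.sum_congr rfl fun k _ ↦ ?_
    rw [mul_assoc, hexp]
  have hPc : ∀ k i, Continuous (P k i) := fun k i ↦ by rw [hP]; fun_prop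
  simp_rw [hpt]
  have i0 : IntervalIntegrable (fun s ↦ ((wL : ℝ) - c.W) * s ^ q) volume c.u c.v :=
    (continuous_const.mul (continuous_pow q)).intervalIntegrable _ _
  have iK : ∀ k, IntervalIntegrable
      (fun s ↦ (c.coeff k : ℝ) * ∑ i ∈ Finset.range (k + 2), P k i s) volume c.u c.v :=
    fun k ↦ (continuous_const.mul (continuous_finsetSum _ fun i _ ↦ hPc k i)).intervalIntegrable _ _
  have iS : IntervalIntegrable (fun s ↦ ∑ k ∈ Finset.range c.c.length,
      (c.coeff k : ℝ) * ∑ i ∈ Finset.range (k + 2), P k i s) volume c.u c.v :=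
    (continuous_finsetSum _ fun k _ ↦
      continuous_const.mul (continuous_finsetSum _ fun i _ ↦ hPc k i)).intervalIntegrable _ _
  rw [intervalIntegral.integral_sub i0 iS, intervalIntegral.integral_const_mul,
    integral_pow_eq_powIntQ, intervalIntegral.integral_finsetSum fun k _ ↦ iK k]
  unfold momentQ
  rw [sumR_eq_sum]
  push_cast
  congr 1
  refine Finset.sum_congr rfl fun k _ ↦ ?_
  rw [intervalIntegral.integral_const_mul,
    intervalIntegral.integral_finsetSum fun i _ ↦ (hPc k i).intervalIntegrable _ _, sumR_eq_sum]
  push_cast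
  congr 1
  refine Finset.sum_congr rfl fun i _ ↦ ?_
  rw [hP]
  simp only
  rw [intervalIntegral.integral_const_mul, integral_pow_eq_powIntQ]

end WeilCell

/-- The moments of `γ_{≥0}`: `Σ_j momentQ_j`. [folklore] -/
def cellsMomentQ (wL : ℚ) : List WeilCell → ℕ → ℚ
  | [], _ => 0
  | c :: cs, q => c.momentQ wL q + cellsMomentQ wL cs q

section Moments

variable {p : ℕ} {wL : ℚ}

/-- The cell integrands `1_{[u,v)} (wL − σ) s^q` are integrable. [folklore] -/
theorem integrable_indicator_cell (wL : ℚ) (c : WeilCell) (q : ℕ) :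
    Integrable fun s : ℝ ↦ Set.indicator (Ico (c.u : ℝ) c.v)
      (fun s ↦ ((wL : ℝ) - c.sigma s) * s ^ q) s := by
  rw [integrable_indicator_iff measurableSet_Ico]
  exact (((continuous_const.sub c.continuous_sigma).mul (continuous_pow q)).continuousOn.integrableOn_Icc
    (a := (c.u : ℝ)) (b := c.v)).mono_set Ico_subset_Icc_self

/-- **Moments of `γ_{≥0}`.** `s ↦ γ_{≥0}(s) s^q` is integrable and `∫ γ_{≥0}(s) s^q ds = Σ_j momentQ_j`. [folklore] -/
theorem integral_gammaAux_mul_pow {cells : List WeilCell} (hall : ∀ c ∈ cells, c.check p wL = true)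
    (q : ℕ) :
    Integrable (fun s ↦ gammaAux wL cells s * s ^ q) ∧
      ∫ s, gammaAux wL cells s * s ^ q = (cellsMomentQ wL cells q : ℝ) := by
  induction cells with
  | nil => simp [gammaAux, cellsMomentQ]
  | cons c cs ih =>
    obtain ⟨ihi, ihv⟩ := ih fun c' hc' ↦ hall c' (by simp [hc'])
    have huv : (c.u : ℝ) ≤ c.v := by exact_mod_cast (WeilCell.u_lt_v (hall c (by simp))).le
    have e : (fun s ↦ gammaAux wL (c :: cs) s * s ^ q) = fun s ↦
        Set.indicator (Ico (c.u : ℝ) c.v) (fun s ↦ ((wL : ℝ) - c.sigma s) * s ^ q) s +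
          gammaAux wL cs s * s ^ q := by
      funext s
      simp only [gammaAux, add_mul, Set.indicator_mul_left]
    rw [e]
    have i1 := integrable_indicator_cell wL c q
    refine ⟨i1.add ihi, ?_⟩
    rw [integral_add i1 ihi, ihv, integral_indicator measurableSet_Ico, integral_Ico_eq_integral_Ioo,
      ← integral_Ioc_eq_integral_Ioo, ← intervalIntegral.integral_of_le huv,
      WeilCell.integral_level_sub_sigma_mul_pow, cellsMomentQ]
    push_cast
    ring

variable {T : ℚ} {mwT : ℕ} {cells : List WeilCell}

/-- **Moments of `γ`.** For even `q`, `t ↦ γ(t) t^q` is integrable and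
`∫ γ(t) t^q dt = 2 Σ_j momentQ_j(q)`. [folklore] -/
theorem integral_cellsGamma_mul_pow (h : checkCells p wL T mwT cells = true) {q : ℕ} (hq : Even q) :
    Integrable (fun t ↦ cellsGamma wL cells t * t ^ q) ∧
      ∫ t, cellsGamma wL cells t * t ^ q = 2 * (cellsMomentQ wL cells q : ℝ) := by
  obtain ⟨hchain, hall, -⟩ := checkCells_spec h
  obtain ⟨hFi, hFv⟩ := integral_gammaAux_mul_pow hall q
  set F : ℝ → ℝ := fun s ↦ gammaAux wL cells s * s ^ q with hF
  have hev : (fun t ↦ cellsGamma wL cells t * t ^ q) = fun t ↦ F |t| := by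
    funext t
    rw [hF, cellsGamma]
    simp only
    rw [hq.pow_abs]
  rw [hev]
  -- support of `F` is in `[0, T]`
  have hF0 : ∀ s, s ∉ Ici (0 : ℝ) → F s = 0 := fun s hs ↦ by
    rw [hF]
    simp only
    rw [gammaAux_eq_zero hchain hall (Or.inl (by simpa using hs)), zero_mul]
  constructor
  · -- integrability of `F ∘ |·|`: bounded with compact support, measurable
    obtain ⟨B, hB⟩ := exists_abs_gammaAux_le wL cells
    have hT0 : (0 : ℝ) ≤ T := by exact_mod_cast (chain_bounds hchain hall).1
    have hmeas : Measurable fun t ↦ F |t| := by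
      rw [hF]
      exact ((measurable_gammaAux wL cells).mul (measurable_id.pow_const q)).comp
        continuous_abs.measurable
    have hconst : IntegrableOn (fun _ : ℝ ↦ B * (T : ℝ) ^ q) (Icc (-(T : ℝ)) T) :=
      integrableOn_const measure_Icc_lt_top.ne
    refine Integrable.mono' ((integrable_indicator_iff measurableSet_Icc).2 hconst)
      hmeas.aestronglyMeasurable (Eventually.of_forall fun t ↦ ?_)
    by_cases ht : |t| < T
    · have hmem : t ∈ Icc (-(T : ℝ)) T := ⟨by linarith [neg_abs_le t], by linarith [le_abs_self t]⟩
      rw [Set.indicator_of_mem hmem, hF, Real.norm_eq_abs]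
      simp only
      rw [abs_mul, abs_pow, abs_abs]
      exact mul_le_mul (hB _) (pow_le_pow_left₀ (abs_nonneg t) ht.le q) (by positivity)
        ((abs_nonneg _).trans (hB 0))
    · push Not at ht
      rw [hF, Real.norm_eq_abs]
      simp only
      rw [gammaAux_eq_zero hchain hall (Or.inr ht), zero_mul, abs_zero]
      exact Set.indicator_nonneg (fun _ _ ↦ by
        have := (abs_nonneg _).trans (hB 0); positivity) _
  · rw [integral_comp_abs (f := F), ← integral_Ici_eq_integral_Ioi,
      setIntegral_eq_integral_of_forall_compl_eq_zero hF0, hFv]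

end Moments

end Literature.NumberTheory.LFunctions
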